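/-
Copyright (c) 2026. All rights reserved.
Released under Apache 2.0 license as described in the file LICENSE.
Authors: abc-iut cell, prover seat abc-iut-w5-d097 (wave 5), over the statements of abc-iut-L4-t3.
-/
import Mathlib.CategoryTheory.InducedCategory
import Mathlib.CategoryTheory.Types.Basic
import Literature.AnabelianGeometry.AbsoluteAnabelian.LogFrobeniusIncompatibility
import Literature.AnabelianGeometry.AbsoluteAnabelian.LogFrobeniusContactProofs
import HarnessLib

/-!
# [AbsTopIII] Corollary 5.5 (iv), second sentence (`Cor55NotSimultaneouslyCompatible`, FACT-LIST F-3190): the typed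
# statement FAILS at the EMPTY setting — with `LogFrobeniusNotSimCompatNonVacuity.lean`, F-3190 is INDEPENDENT of the interface

S. Mochizuki, *Topics in absolute anabelian geometry III: global reconstruction algorithms*,
J. Math. Sci. Univ. Tokyo 22 (2015) 939–1156 [MochizukiAbsTopIII2015]; locators `p.N` = pages of the author's manuscript
(`paper:url-5493eb38cbb7`): Def 3.5 (ii)–(iv) pp. 75–76 (families of homotopies, observables, cores, telecores, contact
structures, "compatible" collections), Def 5.4 (ii), (iv), (vii) pp. 125–128, Cor 5.5 (ii)–(iv) pp. 130–131.

PROOF-ONLY companion (theorems only; nothing restated) of abc-iut-L4-t3's `LogFrobeniusIncompatibility.lean` (the typed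
second sentence `LogFrobeniusSetting.Cor55NotSimultaneouslyCompatible L T` = F-3190), of abc-iut-L4-t5's discharge of
Cor 5.5 (ii) with pinned contact structure (`cor55TelecoreContact_holds`, `LogFrobeniusContactProofs.lean`) and of this
seat's `LogFrobeniusNotSimCompatNonVacuity.lean` (p430816: F-3190 HOLDS at a setting, together with `Cor55LogWall`).  Here
the other half:

* `exists_not_cor55NotSimultaneouslyCompatible` — over every NONEMPTY index set there are a setting `L` and
  `TS`-homotopies `T` at which Cor 5.5 (ii) with pinned contact structure HOLDS (`Cor55TelecoreContact`, L4-t5's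
  theorem), the observables of Cor 5.5 (iii) EXIST in both halves (`Cor55Observables`, `Cor55ObservablesTS`), and yet
  the typed second sentence of Cor 5.5 (iv) FAILS: the telecore `𝔗_{An•}`, its contact structure `ℋ_{An•}` and all the
  observables `S_log⊞_v`, `S_log_v` DO embed into one family of homotopies on `D_{An•}`.  The witness is the EMPTY
  setting: every row of `D•`/`D⊢` is the empty large category (`InducedCategory (Type u) PEmpty.elim`), every structure
  functor the identity; on it every natural transformation between path functors is unique, so L4-t5's telecore and
  contact structure, the observables (all boundary pairs ending at the observation vertex — the printed conditions on
  components are vacuous) and the family of ALL co-verticial pairs on `D_{An•}` are pairwise compatible.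
* `not_forall_cor55NotSimultaneouslyCompatible` — hence F-3190 as a CLOSED statement (quantified over the interface and
  `T`) is false; with p430816 (`exists_cor55NotSimultaneouslyCompatible`: it holds at the (diagonal-ι⊞, `twistTS`)
  witness) the typed second sentence of Cor 5.5 (iv) is INDEPENDENT of the interface `LogFrobeniusSetting` /
  `TSHomotopies`: neither provable nor refutable from the typing — correctly a NAMED HYPOTHESIS quoting print, exactly like
  F-0141 (`Cor55Incompatibility`, abc-iut-w4-d095 p424770 + p427401) and F-3082 (`Cor55LogWall`, w4-d095 p429759 + p429854).

HONEST LABEL: the empty setting is the MOST degenerate model of the interface (no objects anywhere); it calibrates the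
typed statement only — it shows that the `¬∃` of F-3190 is not forced by the typing.  A witness with nonempty rows
(e.g. the diagonal setting on `AddCommGrpCat`) would additionally need the strictness of L4-t5's universal telecore
there; not attempted.  Refereed pre-IUT material; nothing here bears on [IUTchIII] Cor. 3.12; OUR kernel check; no side
taken.
-/

set_option autoImplicit false

universe u

open CategoryTheory Quiver

namespace Literature.AnabelianGeometry.AbsoluteAnabelian

/-! ## Empty categories: functors and natural transformations out of them are unique -/

section EmptyLemmas

variable {A : Type*} [Category A] {B : Type*} [Category B]

/-- Two functors out of an empty category are equal. [folklore] -/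
private theorem functor_eq_of_isEmpty (hA : IsEmpty A) (F G : A ⥤ B) : F = G :=
  Functor.ext (fun X => hA.elim X) (fun X => hA.elim X)

/-- Two natural transformations between functors out of an empty category are equal. [folklore] -/
private theorem natTrans_eq_of_isEmpty (hA : IsEmpty A) {F G : A ⥤ B} (α β : F ⟶ G) : α = β :=
  NatTrans.ext (funext fun X => hA.elim X)

/-- Natural transformations between functors out of an empty category are heterogeneously equal (the functors being
equal). [folklore] -/
private theorem heq_natTrans_of_isEmpty (hA : IsEmpty A) {F G F' G' : A ⥤ B} (α : F ⟶ G) (β : F' ⟶ G') :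
    HEq α β := by
  obtain rfl := functor_eq_of_isEmpty hA F F'
  obtain rfl := functor_eq_of_isEmpty hA G G'
  exact heq_of_eq (natTrans_eq_of_isEmpty hA α β)

end EmptyLemmas

namespace DiagramOfCategories

variable {V : Type u} [Quiver.{u} V] (D : DiagramOfCategories.{u, u + 1, u} V)

/-- **On a diagram all of whose categories are EMPTY, every saturated set of co-verticial pairs is the boundary set of
a family of homotopies** (Def 3.5 (ii)): all co-verticial path functors coincide and the homotopies — necessarily
unique — are the `eqToHom`s. [cite: MochizukiAbsTopIII2015, Definition 3.5 (ii) p.75] -/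
theorem exists_homotopyFamily_of_isEmpty (hD : ∀ a : V, IsEmpty (D.obj a))
    (T : ∀ ⦃a b : V⦄, Path a b → Path a b → Prop) (hT : IsSaturated T) :
    ∃ H : D.HomotopyFamily, ∀ ⦃a b : V⦄ (p q : Path a b), H.E p q ↔ T p q :=
  ⟨{ E := T
     isSaturated := hT
     η := fun ⦃a _ p q⦄ _ => eqToHom (functor_eq_of_isEmpty (hD a) (D.pathFunctor p) (D.pathFunctor q))
     η_refl := fun ⦃a _ _⦄ _ => natTrans_eq_of_isEmpty (hD a) _ _
     η_trans := fun ⦃a _ _ _ _⦄ _ _ => natTrans_eq_of_isEmpty (hD a) _ _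
     η_whisker := fun ⦃_ _ c _ _ _⦄ _ _ _ => natTrans_eq_of_isEmpty (hD c) _ _ }, fun _ _ _ _ => Iff.rfl⟩

/-- In an extension shape WITHOUT telecore edges (an observable shape, Def 3.5 (iii)) every path out of the observation
vertex stays there. [cite: MochizukiAbsTopIII2015, Definition 3.5 (iii) p.75] -/
theorem eq_obs_of_path_obs (X : ExtShape.{u} V) (hX : ∀ a, IsEmpty (X.J a)) {c : X.Vertex} (r : Path X.obs c) :
    c = X.obs := by
  induction r with
  | nil => rfl
  | cons r e ih =>
    subst ih
    rename_i c
    cases c with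
    | base a => exact ((hX a).false e).elim
    | obs => rfl

/-- Hence the set of co-verticial pairs ENDING at the observation vertex is saturated (§0 (a)–(e)).
[cite: MochizukiAbsTopIII2015, Section 0 p.26] -/
theorem isSaturated_endsAtObs (X : ExtShape.{u} V) (hX : ∀ a, IsEmpty (X.J a)) :
    IsSaturated (V := X.Vertex) (fun _ b _ _ => b = X.obs) where
  refl_left _ _ _ _ h := h
  refl_right _ _ _ _ h := h
  trans _ _ _ _ _ h _ := h
  precomp _ _ _ _ _ h _ := h
  postcomp _ b c _ _ h r := by
    subst h
    exact eq_obs_of_path_obs X hX r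

end DiagramOfCategories

namespace LogFrobeniusSetting

variable (Vmod : Type u) (isArc : Vmod → Bool)

/-- **F-3190 FAILS at the EMPTY setting** (and Cor 5.5 (ii) with pinned contact structure and Cor 5.5 (iii), both halves,
HOLD there): over every nonempty index set there are `L`, `T` with `Cor55TelecoreContact`, `Cor55Observables`,
`Cor55ObservablesTS T` and `¬ Cor55NotSimultaneouslyCompatible T` — L4-t5's telecore `𝔗_{An•}` with its pinned contact
structure `ℋ_{An•}`, the observables and the family of ALL co-verticial pairs of `D_{An•}` are pairwise compatible, every
natural transformation on the empty setting being unique.  DEGENERATE calibration witness (the most degenerate model of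
the interface). [cite: MochizukiAbsTopIII2015, Cor 5.5 (iv) p. 131] -/
theorem exists_not_cor55NotSimultaneouslyCompatible [Nonempty Vmod] :
    ∃ (L : LogFrobeniusSetting Vmod isArc) (T : L.TSHomotopies), L.Cor55TelecoreContact ∧ L.Cor55Observables ∧
      L.Cor55ObservablesTS T ∧ ¬ L.Cor55NotSimultaneouslyCompatible T := by
  -- an EMPTY large category (the category induced from `Type u` along `PEmpty.elim`) and the empty setting on it
  obtain ⟨C, _instC, hC⟩ : ∃ (C : Type (u + 1)) (_ : Category.{u} C), IsEmpty C :=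
    ⟨InducedCategory (Type u) (PEmpty.elim : PEmpty.{u + 2} → Type u), inferInstance,
      inferInstanceAs (IsEmpty PEmpty.{u + 2})⟩
  let L₀ : LogFrobeniusSetting Vmod isArc :=
    { X := C
      E := C
      proj := 𝟭 C
      log := 𝟭 C
      logIsoId := Iso.refl _
      logOver := Iso.refl _
      Nplus := fun _ => C
      N := fun _ => C
      forget := fun _ => 𝟭 C
      toE := fun _ => 𝟭 C
      lam := fun _ _ => 𝟭 C
      lamOver := fun _ _ => Iso.refl _
      lam_spaceLink_eq_postLog := fun _ => rfl
      iota := fun _ _ _ _ => eqToHom (functor_eq_of_isEmpty hC _ _)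
      An := C
      κAn := CategoryTheory.Equivalence.refl
      φAn := 𝟭 C
      φAn_isEquivalence := inferInstance
      ηAn := Iso.refl _
      κAn₂ := CategoryTheory.Equivalence.refl
      Emono := C
      monoAn := 𝟭 C
      NmonoPlus := fun _ => C
      Nmono := fun _ => C
      forgetMono := fun _ => 𝟭 C
      toEmono := fun _ => 𝟭 C
      monoNplus := fun _ => 𝟭 C
      monoN := fun _ => 𝟭 C
      monoHomotopy := fun _ => Iso.refl _
      AnMono := C
      κAnMono := CategoryTheory.Equivalence.refl
      ψAnMono := fun _ _ => 𝟭 C }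
  let T₀ : L₀.TSHomotopies :=
    { iota := fun _ _ _ _ => eqToHom (functor_eq_of_isEmpty hC _ _)
      iota_toTS := fun _ _ _ _ => natTrans_eq_of_isEmpty hC _ _ }
  -- every vertex category of `D•⊢`, and of the presentations, is empty
  have hV : ∀ x : DVertex Vmod isArc, IsEmpty (x.category L₀) := by
    intro x; cases x <;> exact hC
  have hSub : ∀ (P : DVertex Vmod isArc → Prop) (a : DSub P), IsEmpty ((L₀.subdiagram P).obj a) :=
    fun P a => hV a.1
  have hExt : ∀ (P : DVertex Vmod isArc → Prop) (x : DVertex Vmod isArc) (a : (obsShape P x).Vertex),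
      IsEmpty (((L₀.subdiagram P).extend (L₀.obsExt P x)).obj a) := by
    intro P x a
    cases a with
    | base a => exact hV a.1
    | obs => exact hV x
  -- Cor 5.5 (ii) with pinned contact structure (abc-iut-L4-t5), at `L₀`
  have hTC : L₀.Cor55TelecoreContact := L₀.cor55TelecoreContact_holds
  -- the observables: all pairs ending at the observation vertex (the printed conditions on components are vacuous)
  have hObsP : ∀ v : Vmod, ∃ H : (L₀.logDiagramPlus v).HomotopyFamily, L₀.IsLogObservablePlus v H ∧
      ∀ ⦃a b⦄ (p q : Path a b), H.E p q ↔ b = (logShapePlus (isArc := isArc) v).obs := by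
    intro v
    obtain ⟨H, hH⟩ := DiagramOfCategories.exists_homotopyFamily_of_isEmpty (L₀.logDiagramPlus v)
      (hExt (DVertex.InFirstRows 2) (.nplus v)) _
      (DiagramOfCategories.isSaturated_endsAtObs (logShapePlus (isArc := isArc) v)
        (fun _ => (inferInstance : IsEmpty PEmpty.{u + 1})))
    refine ⟨H, ⟨fun _ _ _ _ h => (hH _ _).mp h, fun ν₁ ν₂ ε h₁ h₂ => ⟨(hH _ _).mpr rfl, fun X₀ => isEmptyElim X₀⟩,
      fun ν₁ ν₂ ε h₁ h₂ hsl n => ⟨(hH _ _).mpr rfl, fun X₀ => isEmptyElim X₀⟩⟩, hH⟩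
  have hObsT : ∀ v : Vmod, ∃ H : (L₀.logDiagramTS v).HomotopyFamily, L₀.IsLogObservableTS T₀ v H ∧
      ∀ ⦃a b⦄ (p q : Path a b), H.E p q ↔ b = (logShapeTS (isArc := isArc) v).obs := by
    intro v
    obtain ⟨H, hH⟩ := DiagramOfCategories.exists_homotopyFamily_of_isEmpty (L₀.logDiagramTS v)
      (hExt (InPortionThree v) (.nv v)) _
      (DiagramOfCategories.isSaturated_endsAtObs (logShapeTS (isArc := isArc) v)
        (fun _ => (inferInstance : IsEmpty PEmpty.{u + 1})))
    refine ⟨H, ⟨fun _ _ _ _ h => (hH _ _).mp h, fun ν₁ ν₂ ε h₁ h₂ => ⟨(hH _ _).mpr rfl, fun X₀ => isEmptyElim X₀⟩,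
      fun ν₁ ν₂ ε h₁ h₂ hsl n => ⟨(hH _ _).mpr rfl, fun X₀ => isEmptyElim X₀⟩⟩, hH⟩
  choose Hplus hHplus hEplus using hObsP
  choose Hts hHts hEts using hObsT
  refine ⟨L₀, T₀, hTC, fun v => ⟨Hplus v, hHplus v⟩, fun v => ⟨Hts v, hHts v⟩, ?_⟩
  -- unpack the telecore with contact structure and embed everything into the family of ALL pairs on `D_{An•}`
  obtain ⟨H, hH, hc, Tl, hJ, htel, Hc, hcontact, hgen⟩ := hTC
  have hTel : ∀ a : (anTelecoreShape (isArc := isArc) Tl.J).Vertex, IsEmpty ((L₀.anTelecoreDiagram Tl.J Tl.telMap).obj a) := by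
    intro a
    cases a with
    | base a => exact hV a.1
    | obs => exact hC
  obtain ⟨K, hK⟩ := DiagramOfCategories.exists_homotopyFamily_of_isEmpty (L₀.anTelecoreDiagram Tl.J Tl.telMap) hTel
    covert isSymmSaturated_covert.toIsSaturated
  intro hns
  refine hns ⟨H, hH, hc, Tl, hJ, htel, Hc, Hplus, Hts, K, hcontact, hgen, fun v => ⟨hHplus v, hHts v⟩, ?_, ?_, ?_⟩
  · -- `𝔍 ⊆ K`
    intro a b p q h
    exact ⟨(hK p q).mpr trivial, natTrans_eq_of_isEmpty (hTel a) _ _⟩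
  · -- `ℋ_{An•} ⊆ K`
    intro a b p q h
    exact ⟨(hK p q).mpr trivial, natTrans_eq_of_isEmpty (hTel a) _ _⟩
  · -- the observables embed into `K` along `embPlus` / `embTS`
    intro v
    refine ⟨fun a b p q h => ⟨(hK _ _).mpr trivial, ?_⟩, fun a b p q h => ⟨(hK _ _).mpr trivial, ?_⟩⟩
    · obtain rfl : b = _ := (hEplus v p q).mp h
      cases a with
      | base a => exact heq_natTrans_of_isEmpty (hV a.1) _ _
      | obs => exact heq_natTrans_of_isEmpty (hV (.nplus v)) _ _
    · obtain rfl : b = _ := (hEts v p q).mp h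
      cases a with
      | base a => exact heq_natTrans_of_isEmpty (hV a.1) _ _
      | obs => exact heq_natTrans_of_isEmpty (hV (.nv v)) _ _

/-- **F-3190 as a closed statement is false**: not every `(L, T)` satisfies the typed second sentence of Cor 5.5 (iv) (index
set one place).  With `exists_cor55NotSimultaneouslyCompatible` (`LogFrobeniusNotSimCompatNonVacuity.lean`: it HOLDS at a
setting) the row is INDEPENDENT of the interface — an assumption on `(L, T)` quoting print, whose interface-level content at
the places where it can be checked is the nonarchimedean two-path obstruction (`cor55NotSimultaneouslyCompatible_of_nonarchObstruction`).
[cite: MochizukiAbsTopIII2015, Cor 5.5 (iv) p. 131] -/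
theorem not_forall_cor55NotSimultaneouslyCompatible :
    ¬ ∀ (Vmod : Type u) (isArc : Vmod → Bool) (L : LogFrobeniusSetting Vmod isArc) (T : L.TSHomotopies),
      L.Cor55NotSimultaneouslyCompatible T := by
  intro h
  obtain ⟨L, T, -, -, -, hL⟩ := exists_not_cor55NotSimultaneouslyCompatible PUnit.{u + 1} (fun _ => false)
  exact hL (h _ _ L T)

end LogFrobeniusSetting

end Literature.AnabelianGeometry.AbsoluteAnabelian
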